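import Summits.FinalStateConjecture.FinalStateConjecture.Theorems.SwallowTheDatumKerrShieldedSettlesStubKerrLeafSojournAux1
import Summits.FinalStateConjecture.FinalStateConjecture.Theorems.SwallowTheDatumKerrShieldedSettlesStubCollarCauchy
import Summits.FinalStateConjecture.FinalStateConjecture.Theorems.KerrShieldedDataExist.Negative.SliceClause
import Literature.Geometry.Lorentzian.KerrSchildDerivativeDecay
import Literature.Geometry.Lorentzian.OpensCausality
import HarnessLib

/-!
# `KerrShieldedSettles`, line `tapered-temporal-collar` — stub S4 `stub_kerrLeafSojourn`, part 3:
# the bent leaf seen from the chart: an explicit region of `J⁺(ψ{r ≤ 10M})` and the energy of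
# normalised rays

Support file for crux `stmt-FinalStateConjecture-10054`
(`Summit.FinalStateConjecture.FinalStateConjecture.Theses.SwallowTheDatum.KerrShieldedSettles`), stub
`stub_kerrLeafSojourn`.  Two facts about the pinned bent leaf `ψ = graph M a r₁` (`t* = T_{M,a}(r)`):

* `mem_causalFuture_of_segment`: a straight chart segment whose direction `w` is `g`-timelike at every
  one of its points, with `w⁰ > 0`, lies in the chart and is a future timelike curve, so its endpoint lies
  in `J⁺` of its starting point;
* `leaf_cone_mem_causalFuture` (**the explicit region**): every chart point `x` with `‖x⃗‖ ≥ 10M` and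
  `x⁰ ≥ 2‖x⃗‖ − 14M` lies in `J⁺(ψ{r ≤ 10M})` — the segment from the leaf point over the radial
  projection `y₀ = (10M/‖x⃗‖) x⃗` (height `T ≤ r/2 + M ≤ 6M`, `r(y₀) ≤ ‖y₀‖ = 10M`) to `x` has chart
  slope `≤ 1/2` and stays in `{r ≥ 9M}`, where such directions are timelike (inner cone,
  `bilin_self_neg_of_cone`);
* `energy_le_five`: for a future unit normal field `ν` of the leaf and a null `w` at a leaf point of
  spatial radius `≥ 16M + |a| + 1` normalised by `g(w, ν) = −1`, the Killing energy satisfies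
  `0 < −g(w, ∂_{t*}) ≤ 5` whenever `w⁰ > 0` — the sibling crux's `ks_energy_pinning` (lapse and shift of
  the far part of the bent leaf are close to Minkowski's), fed with `dψ v = (dh v, v)`,
  `‖dh‖ ≤ 1/6`, `H ≤ 1/16` (`far_leaf_numerics`) and the timecone lemma for `g(ν, ∂_{t*}) < 0`.

References: O'Neill 1983, Ch. 5, Lemma 5.29 and p. 145, Ch. 14, p. 402; Cook, Living Rev. Relativ. 3
(2000), §3.2.2; Dafermos–Rodnianski arXiv:0811.0354, §5.1.
-/

set_option linter.dupNamespace false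

noncomputable section

open Set Filter
open scoped Manifold ContDiff Topology
open Literature.Geometry.Lorentzian
open Summit.FinalStateConjecture.FinalStateConjecture.Theorems.KerrShieldedDataExist.Negative
  (bentHeight graph coe_graph coe_graph_eq bentHeightFun hasMFDerivAt_graph fderiv_bentHeightFun mass_pos
  rMinus_nonneg rPlus_le_two_mul bentSlope_eq_of_ge blSlope_le delta_pos)
open Summit.FinalStateConjecture.FinalStateConjecture.Theorems.StarvedNecks.OneOverDelta.FarEnd (ks_apply_basisVector_zero ks_energy_pinning)

namespace Summit.FinalStateConjecture.FinalStateConjecture.Theorems.SwallowTheDatum.KerrShieldedSettles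

namespace KerrLeafSojourn

section Segment

variable [Kerr.Facts] {M a r₁ : ℝ}

/-- **Straight timelike chart segments realise `J⁺`.** If the chart segment from `p` to `q` (both in
`Kerr.region a r₁`) stays in the chart and its direction `w = q − p` has `w⁰ > 0` and is `g`-timelike at
every point of the segment, then `q ∈ J⁺({p})`: the segment, extended by `p` off the chart, is a future
timelike curve of the chart on `[0, 1]`. O'Neill 1983, Ch. 14, p. 402. [cite: ONeillSemiRiemannian1983, Ch. 14, p. 402] -/
theorem mem_causalFuture_of_segment (hM : 0 ≤ M) (p q : Kerr.region a r₁)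
    (hmem : ∀ σ ∈ Icc (0 : ℝ) 1, (p : E4) + σ • ((q : E4) - p) ∈ Kerr.region a r₁)
    (htl : ∀ σ ∈ Icc (0 : ℝ) 1,
      Kerr.bilin M a ((p : E4) + σ • ((q : E4) - p)) ((q : E4) - p) ((q : E4) - p) < 0)
    (h0 : 0 < ((q : E4) - (p : E4)) 0) :
    q ∈ (Kerr.smoothMetric M a r₁).causalFuture ((Kerr.timeOrientation M a r₁ hM).ofLE le_top) {p} := by
  classical
  set w : E4 := (q : E4) - p with hw
  set L : ℝ → E4 := fun σ ↦ (p : E4) + σ • w with hL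
  set γ : ℝ → Kerr.region a r₁ := fun σ ↦ if h : L σ ∈ Kerr.region a r₁ then ⟨L σ, h⟩ else p with hγ
  have hLd : ∀ σ, HasDerivAt L w σ := fun σ ↦ by
    have h := ((hasDerivAt_id σ).smul_const w).const_add (p : E4)
    rwa [one_smul] at h
  have hO : IsOpen (L ⁻¹' (Kerr.region a r₁ : Set E4)) :=
    (Kerr.region a r₁).2.preimage (continuous_const.add (continuous_id.smul continuous_const))
  have hγL : ∀ σ, L σ ∈ Kerr.region a r₁ → (γ σ : E4) = L σ := fun σ h ↦ by
    simp only [hγ, dif_pos h]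
  have hcurve : (Kerr.smoothMetric M a r₁).IsFutureTimelikeCurveOn
      ((Kerr.timeOrientation M a r₁ hM).ofLE le_top) γ (Icc 0 1) := by
    intro σ hσ
    have hσm := hmem σ hσ
    have hev : (fun σ' ↦ (γ σ' : E4)) =ᶠ[𝓝 σ] L :=
      Filter.eventuallyEq_of_mem (hO.mem_nhds hσm) fun σ' h ↦ hγL σ' h
    have hd : HasDerivAt (fun σ' ↦ (γ σ' : E4)) w σ := (hLd σ).congr_of_eventuallyEq hev
    have hmd : MDifferentiableAt 𝓘(ℝ, ℝ) 𝓘(ℝ, E4) γ σ :=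
      (mdifferentiableAt_subtypeVal_comp_curve_iff (I := 𝓘(ℝ, E4)) (Kerr.region a r₁)).1
        (mdifferentiableAt_iff_differentiableAt.2 hd.differentiableAt)
    have hv : (velocity 𝓘(ℝ, E4) γ σ : E4) = w := by
      rw [CollarCauchy.velocity_eq_deriv, hd.deriv]
    have hx : 0 < Kerr.radius a (γ σ) := Kerr.radius_pos_of_mem_region (γ σ).2
    have hpt : (γ σ : E4) = L σ := hγL σ hσm
    have htl' : Kerr.bilin M a (γ σ) w w < 0 := by rw [hpt]; exact htl σ hσ
    have hne : w ≠ 0 := fun h ↦ by rw [h] at h0; simp at h0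
    refine ⟨hmd, ?_, ⟨?_, ?_⟩, ?_⟩
    · change Kerr.bilin M a (γ σ) (velocity 𝓘(ℝ, E4) γ σ) (velocity 𝓘(ℝ, E4) γ σ) < 0
      rw [hv]; exact htl'
    · change Kerr.bilin M a (γ σ) (velocity 𝓘(ℝ, E4) γ σ) (velocity 𝓘(ℝ, E4) γ σ) ≤ 0
      rw [hv]; exact htl'.le
    · intro h; exact hne (hv.symm.trans h)
    · change Kerr.bilin M a (γ σ) (Kerr.timeVector M a (γ σ)) (velocity 𝓘(ℝ, E4) γ σ) < 0
      rw [Kerr.bilin_timeVector hx, hv]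
      linarith
  have hγ0 : γ 0 = p := by
    have hL0 : L 0 = p := by simp [hL]
    exact Subtype.ext ((hγL 0 (by rw [hL0]; exact p.2)).trans hL0)
  have hγ1 : γ 1 = q := by
    have hL1 : L 1 = q := by simp [hL, hw]
    exact Subtype.ext ((hγL 1 (by rw [hL1]; exact q.2)).trans hL1)
  exact Or.inr ⟨p, rfl, γ, 0, 1, zero_lt_one, hcurve.isFutureCausalCurveOn, hγ0, hγ1⟩

end Segment

/-! ## The explicit region `{‖x⃗‖ ≥ 10M, x⁰ ≥ 2‖x⃗‖ − 14M} ⊆ J⁺(ψ{r ≤ 10M})` -/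

section Cone

variable [Kerr.Facts] {M a r₁ : ℝ}

omit [Kerr.Facts] in
/-- A point `x : E4` whose spatial norm exceeds `r₁ + |a|` lies in `Kerr.region a r₁`
(`r ≥ ‖x⃗‖ − |a|`), for `r₁ ≥ 0`. [folklore] -/
theorem mem_region_of_norm (h₀ : 0 ≤ r₁) {x : E4} (hx : r₁ + |a| < E4.spatialNorm x) :
    x ∈ Kerr.region a r₁ := by
  rw [Kerr.mem_region, max_eq_left h₀]
  linarith [spatialNorm_sub_le_radius a x]

/-- **The explicit region of `J⁺` of the compact leaf piece.** For sub-extremal `(M, a)`,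
`r₋ < r₁ < r₊`, every chart point `x` with `‖x⃗‖ ≥ 10M` and `x⁰ ≥ 2‖x⃗‖ − 14M` lies in the causal future
of `ψ{r ≤ 10M}`, `ψ = graph M a r₁` the bent leaf: it is the endpoint of the chart segment from the leaf
point over `y₀ = (10M/‖x⃗‖) x⃗` (height `≤ 6M`, `r(y₀) ≤ 10M`), of chart slope `≤ 1/2`, inside
`{r ≥ 9M}` where such directions are future timelike. [cite: ONeillSemiRiemannian1983, Ch. 14, p. 402] -/
theorem leaf_cone_mem_causalFuture (ha : |a| < M) (hM : 0 ≤ M) (h₁ : Kerr.rMinus M a < r₁)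
    (h₂ : r₁ < Kerr.rPlus M a) (x : Kerr.region a r₁) (hρ : 10 * M ≤ E4.spatialNorm x)
    (hx0 : 2 * E4.spatialNorm x - 14 * M ≤ (x : E4) 0) :
    x ∈ (Kerr.smoothMetric M a r₁).causalFuture ((Kerr.timeOrientation M a r₁ hM).ofLE le_top)
      (graph M a r₁ '' {y' : Kerr.slice a r₁ | Kerr.radius a (E4.ofTimeSpace 0 (y' : E3)) ≤ 10 * M}) := by
  have hMp := mass_pos ha
  have hr₁0 : 0 ≤ r₁ := (rMinus_nonneg ha).trans h₁.le
  have hr₁2 : r₁ ≤ 2 * M := h₂.le.trans (rPlus_le_two_mul ha)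
  set ρ := E4.spatialNorm x with hρ_def
  have hρ0 : 0 < ρ := by linarith
  set sx : E3 := E4.spatial (x : E4) with hsx
  have hsxn : ‖sx‖ = ρ := rfl
  set k : ℝ := 10 * M / ρ with hk
  have hk0 : 0 < k := by positivity
  have hk1 : k ≤ 1 := by rw [hk, div_le_one hρ0]; exact hρ
  set y₀ : E3 := k • sx with hy₀
  have hy₀n : ‖y₀‖ = 10 * M := by
    rw [hy₀, norm_smul, Real.norm_eq_abs, abs_of_pos hk0, hsxn, hk, div_mul_cancel₀ _ hρ0.ne']
  -- the leaf point over `y₀`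
  have hy₀r : Kerr.radius a (E4.ofTimeSpace 0 y₀) ≤ 10 * M :=
    (Kerr.radius_le_spatialNorm a _).trans_eq (by rw [E4.spatialNorm_ofTimeSpace, hy₀n])
  have hy₀r' : 9 * M ≤ Kerr.radius a (E4.ofTimeSpace 0 y₀) := by
    have := spatialNorm_sub_le_radius a (E4.ofTimeSpace 0 y₀)
    rw [E4.spatialNorm_ofTimeSpace, hy₀n] at this
    linarith [ha.le]
  have hy₀s : y₀ ∈ Kerr.slice a r₁ := by
    rw [Kerr.mem_slice, max_eq_left hr₁0]; linarith
  set p : Kerr.region a r₁ := graph M a r₁ ⟨y₀, hy₀s⟩ with hp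
  have hpS : p ∈ graph M a r₁ '' {y' : Kerr.slice a r₁ | Kerr.radius a (E4.ofTimeSpace 0 (y' : E3)) ≤ 10 * M} :=
    ⟨⟨y₀, hy₀s⟩, hy₀r, rfl⟩
  have hpE : (p : E4) = E4.ofTimeSpace (bentHeight M a (Kerr.radius a (E4.ofTimeSpace 0 y₀))) y₀ := rfl
  set h₀ := bentHeight M a (Kerr.radius a (E4.ofTimeSpace 0 y₀)) with hh₀
  have hT0 : 0 ≤ h₀ := CollarCauchy.bentHeight_nonneg ha _
  have hT6 : h₀ ≤ 6 * M := by
    have := CollarCauchy.bentHeight_le_half_add ha (Kerr.radius_nonneg a (E4.ofTimeSpace 0 y₀))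
    linarith
  -- the direction of the segment
  set w : E4 := (x : E4) - p with hw
  have hw0 : w 0 = (x : E4) 0 - h₀ := by simp [hw, hpE]
  have hws : E4.spatial w = (1 - k) • sx := by
    rw [hw, map_sub, hpE, E4.spatial_ofTimeSpace, hy₀, ← hsx, sub_smul, one_smul]
  have hwsn : ‖E4.spatial w‖ = ρ - 10 * M := by
    rw [hws, norm_smul, Real.norm_eq_abs, abs_of_nonneg (by linarith), hsxn, hk, sub_mul,
      div_mul_cancel₀ _ hρ0.ne', one_mul]
  have hw0ge : 2 * (ρ - 10 * M) ≤ w 0 := by rw [hw0]; linarith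
  refine LorentzianMetric.causalFuture_mono (singleton_subset_iff.2 hpS) ?_
  rcases (show 0 ≤ w 0 by linarith).eq_or_lt with hz | hpos
  · -- degenerate case: `x` is the leaf point itself
    have hρ10 : ρ = 10 * M := by linarith
    have hxw : (x : E4) = p := by
      have hsp0 : E4.spatial w = 0 := by
        rw [hws, hk, hρ10, div_self (by positivity : (10 : ℝ) * M ≠ 0), sub_self, zero_smul]
      have : w = 0 := by
        rw [← E4.ofTimeSpace_time_spatial w, E4.time_apply, ← hz, hsp0]
        ext i; refine Fin.cases ?_ (fun j ↦ ?_) i <;> simp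
      exact sub_eq_zero.1 this
    rw [show x = p from Subtype.ext hxw]
    exact LorentzianMetric.subset_causalFuture _ _ _ rfl
  · -- the segment from `p` to `x`
    refine mem_causalFuture_of_segment hM p x (fun σ hσ ↦ ?_) (fun σ hσ ↦ ?_) hpos
    all_goals
      have hsp : E4.spatial ((p : E4) + σ • w) = (k + σ * (1 - k)) • sx := by
        rw [map_add, map_smul, hws, hpE, E4.spatial_ofTimeSpace, hy₀, smul_smul, ← add_smul]
      have hcoef : k ≤ k + σ * (1 - k) := by nlinarith [hσ.1, hk1]
      have hnorm : 10 * M ≤ E4.spatialNorm ((p : E4) + σ • w) := by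
        rw [E4.spatialNorm, hsp, norm_smul, Real.norm_eq_abs, abs_of_nonneg (by linarith), hsxn]
        calc 10 * M = k * ρ := by rw [hk, div_mul_cancel₀ _ hρ0.ne']
          _ ≤ (k + σ * (1 - k)) * ρ := mul_le_mul_of_nonneg_right hcoef hρ0.le
      have hr9 : 9 * M ≤ Kerr.radius a ((p : E4) + σ • w) := by
        linarith [spatialNorm_sub_le_radius a ((p : E4) + σ • w), ha.le]
    · exact mem_region_of_norm hr₁0 (by linarith [ha.le])
    · have hx' : 0 < Kerr.radius a ((p : E4) + σ • w) := by linarith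
      refine bilin_self_neg_of_cone hM a hx' (by linarith) hpos ?_
      rw [← E4.spatialNorm_sq, show E4.spatialNorm w = ‖E4.spatial w‖ from rfl, hwsn]
      nlinarith

end Cone

/-! ## The normalisation against the leaf normal pins the Killing energy -/

section Energy

variable [Kerr.Facts] {M a r₁ : ℝ}

omit [Kerr.Facts] in
/-- **The far leaf in numbers.** At a leaf point over `y` with `‖y‖ ≥ 16M + |a| + 1` (`|a| < M`):
`r(0, y) ≥ 16M + 1`, `H ≤ 1/16` at every chart point over `y`, and the slope of the height function is
small, `‖d(T ∘ r)_y‖ ≤ (2M/(r − 2M))(1 + |a|/r) ≤ 1/6` (`T′ = 2Mr/Δ ≤ 2M/(r − 2M)` beyond `8M`,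
`‖∇r‖ ≤ 1 + |a|/r`). [folklore] -/
theorem far_leaf_numerics (ha : |a| < M) {y : E3} (hy : 16 * M + |a| + 1 ≤ ‖y‖) :
    16 * M + 1 ≤ Kerr.radius a (E4.ofTimeSpace 0 y) ∧
      (∀ t : ℝ, Kerr.scalarH M a (E4.ofTimeSpace t y) ≤ 1 / 16) ∧
      ‖fderiv ℝ (bentHeightFun M a) y‖ ≤ 1 / 6 := by
  -- adapted from `OneOverDelta.FarEnd.far_numerics` / `norm_fderiv_bentHeightFun_le`
  have hM := mass_pos ha
  set r := Kerr.radius a (E4.ofTimeSpace 0 y) with hr_def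
  have h1 := spatialNorm_sub_le_radius a (E4.ofTimeSpace 0 y)
  rw [E4.spatialNorm_ofTimeSpace] at h1
  have hr16 : 16 * M + 1 ≤ r := by linarith
  have hr0 : 0 < r := by linarith
  refine ⟨hr16, fun t ↦ ?_, ?_⟩
  · have hrt : Kerr.radius a (E4.ofTimeSpace t y) = r := Kerr.radius_ofTimeSpace a t y
    have h := scalarH_le_inv hM.le a (x := E4.ofTimeSpace t y) (by rw [hrt]; exact hr0) (k := 16)
      (by norm_num) (by rw [hrt]; linarith)
    linarith
  · rw [fderiv_bentHeightFun ha hr0, norm_smul, Real.norm_eq_abs,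
      bentSlope_eq_of_ge hM (show 8 * M ≤ r by linarith)]
    have hrp : Kerr.rPlus M a < r := by linarith [rPlus_le_two_mul ha]
    have hΔ := delta_pos ha hrp
    have hsl : |2 * M * r / (r ^ 2 - 2 * M * r + a ^ 2)| ≤ 2 * M / (r - 2 * M) := by
      rw [abs_of_nonneg (div_nonneg (by positivity) hΔ.le)]
      exact blSlope_le ha (by linarith)
    have hgrad := Kerr.norm_radiusGrad_le_radius hr0
    have h2 : 2 * M / (r - 2 * M) ≤ 1 / 7 := by
      rw [div_le_iff₀ (by linarith)]; linarith
    have h3 : |a| / r ≤ 1 / 16 := by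
      rw [div_le_iff₀ hr0]; linarith [abs_nonneg a]
    calc |2 * M * r / (r ^ 2 - 2 * M * r + a ^ 2)| * ‖Kerr.radiusGrad a y‖
        ≤ 1 / 7 * (1 + 1 / 16) :=
          mul_le_mul (hsl.trans h2) (hgrad.trans (by linarith)) (norm_nonneg _) (by norm_num)
      _ ≤ 1 / 6 := by norm_num

/-- **`0 < E ≤ 5` for normalised rays from the far leaf.** Let `ν` be a future unit normal field of the
bent leaf `ψ = graph M a r₁` (`|a| < M`), `y` a leaf point of spatial radius `‖y‖ ≥ 16M + |a| + 1`, and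
`w` a `g`-null vector at `ψ y` with `w⁰ > 0` normalised by `g(w, ν y) = −1`.  Then its Killing energy
`E = −g(w, ∂_{t*})` satisfies `0 < E ≤ 5` (`ks_energy_pinning` with `dψ v = (dh v, v)`, `‖dh‖ ≤ 1/6`,
`H ≤ 1/16`; `g(ν, ∂_{t*}) < 0` by the timecone lemma). Cook, Living Rev. Relativ. 3 (2000), §3.2.2.
[cite: Cook2000, §3.2.2] -/
theorem energy_pos_le_five (ha : |a| < M) (hM : 0 ≤ M) {ν : NormalField 𝓘(ℝ, E4) (graph M a r₁)}
    (hν : (Kerr.smoothMetric M a r₁).IsFutureUnitNormal 𝓘(ℝ, E3)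
      ((Kerr.timeOrientation M a r₁ hM).ofLE le_top) (graph M a r₁) ν)
    (y : Kerr.slice a r₁) (hy : 16 * M + |a| + 1 ≤ ‖(y : E3)‖) {w : E4}
    (hnull : Kerr.bilin M a (graph M a r₁ y) w w = 0) (hw0 : 0 < w 0)
    (hnorm : Kerr.bilin M a (graph M a r₁ y) w (ν y) = -1) :
    0 < -Kerr.bilin M a (graph M a r₁ y) w (E4.basisVector 0) ∧
      -Kerr.bilin M a (graph M a r₁ y) w (E4.basisVector 0) ≤ 5 := by
  set x : E4 := (graph M a r₁ y : E4) with hx_def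
  have hx : 0 < Kerr.radius a x := Kerr.radius_pos_of_mem_region (graph M a r₁ y).2
  have hxsp : E4.spatial x = (y : E3) := by rw [hx_def, coe_graph, E4.spatial_ofTimeSpace]
  obtain ⟨-, hHall, hdh⟩ := far_leaf_numerics (M := M) ha hy
  have hH : Kerr.scalarH M a x ≤ 1 / 16 := by
    rw [hx_def, coe_graph_eq]; exact hHall _
  -- positivity of the energy from the pinch `(1 − 4H) w⁰ ≤ E`
  have hE : 0 < -Kerr.bilin M a x w (E4.basisVector 0) := by
    have h1 := (energy_pinch hM a hx hnull.le hw0.le).1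
    nlinarith
  refine ⟨hE, ?_⟩
  -- the normal in the form consumed by `ks_energy_pinning`
  have hN1 : ∀ q : E3, Kerr.bilin M a x (ν y) (E4.ofTimeSpace (fderiv ℝ (bentHeightFun M a) (y : E3) q) q) = 0 := by
    intro q
    have h := hν.1.1 y q
    rw [Kerr.smoothMetric_val, (hasMFDerivAt_graph ha y).mfderiv] at h
    have h' : Kerr.bilin M a x (ν y)
        (((fderiv ℝ (bentHeightFun M a) (y : E3)).smulRight (E4.basisVector 0) + E4.spaceEmbed) q) = 0 := h
    rwa [E4.smulRight_add_spaceEmbed_apply] at h'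
  have hN2 : Kerr.bilin M a x (ν y) (ν y) = -1 := hν.1.2 y
  have hVν : Kerr.bilin M a x (Kerr.timeVector M a x) (ν y) < 0 := (hν.2 y).2
  have hN3 : Kerr.bilin M a x (ν y) (E4.basisVector 0) < 0 := by
    refine CollarCauchy.bilin_neg_of_cone hM hx (by rw [hN2]; norm_num) hVν ?_ ?_ ?_
    · have hb : (E4.basisVector 0 : E4) 0 = 1 := by simp
      rw [ks_apply_basisVector_zero, Kerr.nullCovector_basisVector_zero, hb]
      linarith
    · intro h
      have := congrArg (fun v : E4 ↦ v 0) h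
      simp at this
    · rw [Kerr.bilin_timeVector hx]
      simp
  exact ks_energy_pinning hM hx hH hdh hN1 hN2 hN3 hnull hnorm hE

end Energy

end KerrLeafSojourn

open KerrLeafSojourn in
/-- **Registered sub-goal `stub_kerrLeafSojournCone` (an explicit region of `J⁺` of the compact leaf
piece).**  For sub-extremal `(M, a)`, `0 ≤ M`, `r₋ < r₁ < r₊`: every point of the ingoing Kerr–Schild
chart with `‖x⃗‖ ≥ 10M` and `x⁰ ≥ 2‖x⃗‖ − 14M` lies in the causal future of `ψ{r ≤ 10M}`, `ψ` the bent
leaf `graph M a r₁` (straight chart segments of slope `≤ 1/2` issued from the leaf over the sphere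
`‖y‖ = 10M` are future timelike on `{r ≥ 8M}`).  O'Neill 1983, Ch. 14, p. 402.
[cite: ONeillSemiRiemannian1983, Ch. 14, p. 402] -/
theorem stub_kerrLeafSojournCone : ∀ [Kerr.Facts] (M a r₁ : ℝ) (hM : 0 ≤ M), |a| < M →
    Kerr.rMinus M a < r₁ → r₁ < Kerr.rPlus M a → ∀ x : Kerr.region a r₁,
    10 * M ≤ E4.spatialNorm x → 2 * E4.spatialNorm x - 14 * M ≤ (x : E4) 0 →
    x ∈ (Kerr.smoothMetric M a r₁).causalFuture ((Kerr.timeOrientation M a r₁ hM).ofLE le_top)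
      (Summit.FinalStateConjecture.FinalStateConjecture.Theorems.KerrShieldedDataExist.Negative.graph M a r₁ ''
        {y' : Kerr.slice a r₁ | Kerr.radius a (E4.ofTimeSpace 0 (y' : E3)) ≤ 10 * M}) :=
  fun _ _ _ hM ha h₁ h₂ x hρ hx0 ↦ leaf_cone_mem_causalFuture ha hM h₁ h₂ x hρ hx0

end Summit.FinalStateConjecture.FinalStateConjecture.Theorems.SwallowTheDatum.KerrShieldedSettles

end
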